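import Mathlib
import HarnessLib.Audit
import Summits.PneNP.PneNP.Theorems.PstarGateCasePRegimes

/-!
# One GATED chord, CASE P all-(NOR): the unit family of the other chords has at most five outputs and is XOR-closed (E2 node N1, first step; prover-1 g18)

FRONTIER range-avoidance ladder, rung F-N3 (`stmt-PneNP-19007`), cell `pnp-ideate` (this seat's `HOME/pnp-ideate-prover-1/g18/E2-PLAN.md` §2 B2 / N1);
restricted-model proof complexity — nothing here bears on `P` versus `NP`.

In the all-(NOR) regime of CASE P (`PstarGateCasePRegimes.caseP_regimes`, first alternative) the clean unit bound
`PstarNorUnitDirAssembly.card_units_le_five_dir` — which needs no minimality, no peelability and no privates-unread — applies to the CLEAN COMPANION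
(`PstarGateCompanion.companion`; its `q_{(1,0)}` and polar form are the original ones, `PstarGateCasePRegimes.qDir_companion` /
`polarDir_companion`):

* `caseP_nor_units` — **the unit family `U := (N − e) ∪ ⋃_{e' ≠ e} D e'` has `#U ≤ 5` and is XOR-closed** (`xorClosed_units`).
So in this regime `J₀ ⊇ U ∪ (D e + e)` with `U` one of the clean NOR cores (triangle / two triangles on an edge); the remaining count (node N1) is the
gluing of the gated cycle `D e + e` onto `U` under `(r,3/2)`-expansion with the gate's footprint — by the slice condition every edge of `D e` meets the
NOR literals or `u` (`through_of_const_on_flat`, the flat version of `PstarGateHyperplane`), so each costs boundary.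

* `through_of_const_on_flat` — an AND-sum constant on a coordinate flat `{x_v = c_v : v ∈ Γ}` has every edge meeting `Γ`.
-/

set_option linter.dupNamespace false -- `Summit.PneNP.PneNP.…`: summit = sub-problem name (D-0017 single-conjunct layout)

open Finset Module Literature.Computability.Complexity
open scoped symmDiff
open Summit.PneNP.PneNP.Theorems.PstarTyped (Typed)
open Summit.PneNP.PneNP.Theorems.PstarSALevel (varSet bdry BoundaryExpanding SimpleOverlap)
open Summit.PneNP.PneNP.Theorems.PstarXCore (xverts)
open Summit.PneNP.PneNP.Theorems.PstarCoreBound (XorClosed)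
open Summit.PneNP.PneNP.Theorems.PstarCubeIdeals (IsAffineFn)
open Summit.PneNP.PneNP.Theorems.PstarProductRank (qform polar qform_add)
open Summit.PneNP.PneNP.Theorems.PstarPathRank (polar_basis and_ne)
open Summit.PneNP.PneNP.Theorems.PstarReadSumset (V2)
open Summit.PneNP.PneNP.Theorems.PstarChordSystem (ChordSystem)
open Summit.PneNP.PneNP.Theorems.PstarChordBridgeTools (privs coef)
open Summit.PneNP.PneNP.Theorems.PstarChordBridge (BridgeData sys Solution Lift)
open Summit.PneNP.PneNP.Theorems.PstarChordBridgeForcing (gam)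
open Summit.PneNP.PneNP.Theorems.PstarChordBridgeBasis (qDir polarDir)
open Summit.PneNP.PneNP.Theorems.PstarNorUnitDirAssembly (xorClosed_units card_units_le_five_dir)
open Summit.PneNP.PneNP.Theorems.PstarGateBridge (GateHyp)
open Summit.PneNP.PneNP.Theorems.PstarGateCompanion
open Summit.PneNP.PneNP.Theorems.PstarGateCasePRegimes (NorCert qDir_companion polarDir_companion)

namespace Summit.PneNP.PneNP.Theorems.PstarGateCasePNor

variable {n m : ℕ}

/-- **CASE P, all other chords (NOR): the unit family of `N − e` has at most five outputs and is XOR-closed.** -/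
theorem caseP_nor_units (I : LocalMap 4 n m) (hI : I.IsPure xorAndPred) (hT : Typed I) (hS : SimpleOverlap I) {r : ℕ}
    (hB : BoundaryExpanding r I) {B : BridgeData n m} (hW : B.WF I) (hr : (B.J₀ ∪ B.G₁ ∪ B.G₂).card ≤ r) (hJr : B.J₀.card < r)
    (hd₁ : Disjoint B.G₁ B.J₀) (hd₂ : Disjoint B.G₂ B.J₀) {e : Fin m} (hG : GateHyp I B e) (g₀ : Fin m) {u : Fin n}
    (hux : u ∉ xverts I (B.J₀ \ B.N)) (κ₀ : Bool) (hN : (B.N.erase e).Nonempty)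
    (hNOR : ∀ e' ∈ B.N, e' ≠ e → NorCert I B (B.D e') (gam B e')) :
    ((B.N.erase e) ∪ (B.N.erase e).biUnion B.D).card ≤ 5 ∧ XorClosed I ((B.N.erase e) ∪ (B.N.erase e).biUnion B.D) := by
  classical
  set B₀ := companion I B e g₀ u κ₀ with hB₀
  have hW₀ : B₀.WF I := companion_wf I hI hT hW hG g₀ hux κ₀
  have hr₀ : (B₀.J₀ ∪ B₀.G₁ ∪ B₀.G₂).card ≤ r := by
    refine le_trans (card_le_card ?_) hr
    rw [hB₀, companion_J₀, companion_G₁, companion_G₂]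
    exact union_subset_union (union_subset_union (subset_refl _) (erase_subset _ _)) (subset_refl _)
  have hd₁₀ : Disjoint B₀.G₁ B₀.J₀ := by rw [hB₀, companion_G₁, companion_J₀]; exact hd₁.mono_left (erase_subset _ _)
  have hd₂₀ : Disjoint B₀.G₂ B₀.J₀ := by rw [hB₀, companion_G₂, companion_J₀]; exact hd₂
  have hN₀ : B₀.N.Nonempty := by rw [hB₀, companion_N]; exact hN
  have hq := qDir_companion I hI hW hG g₀ u κ₀
  have hpd := polarDir_companion I hI hW hG g₀ u κ₀
  have hNOR₀ : ∀ e' ∈ B₀.N, ∃ a b : Fin n → ZMod 2, ∃ β α : ZMod 2, ∃ m₁ m₂ : (Fin n → ZMod 2) → ZMod 2,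
      polarDir I B₀ (1, 0) a b = 1 ∧
      (∀ x, qDir I B₀ (1, 0) x = (polarDir I B₀ (1, 0) x b + β) * (polarDir I B₀ (1, 0) x a + α) + 1) ∧
      IsAffineFn m₁ ∧ IsAffineFn m₂ ∧
      ∀ x, qform (B₀.D e') (fun j => I.vars j 2) (fun j => I.vars j 3) x + (gam B₀ e' + 1) =
        (polarDir I B₀ (1, 0) x b + β + 1) * m₁ x + (polarDir I B₀ (1, 0) x a + α + 1) * m₂ x := by
    intro e' he'
    rw [hB₀, companion_N] at he'
    obtain ⟨a, b, hab, hqq, m₁, m₂, hm₁, hm₂, hQ⟩ := hNOR e' (mem_of_mem_erase he') (ne_of_mem_erase he')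
    refine ⟨a, b, _, _, m₁, m₂, by rw [hpd]; exact hab, fun x => by rw [hq, hpd]; exact hqq x, hm₁, hm₂, fun x => ?_⟩
    rw [hpd]
    exact hQ x
  have h5 := card_units_le_five_dir I hI hS hB hW₀ hr₀ (by rw [hB₀, companion_J₀]; exact hJr) hd₁₀ hd₂₀ hN₀ (1, 0) hNOR₀
  have hX := xorClosed_units I hI hW₀
  rw [hB₀, companion_N] at h5 hX
  exact ⟨h5, hX⟩

/-- **An AND-sum constant on a coordinate flat meets the frozen coordinates**: if `Q_S(x) = κ` for every `x` agreeing with `c` on `Γ`, then every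
output of `S` has an AND variable in `Γ`. -/
theorem through_of_const_on_flat (I : LocalMap 4 n m) (hI : I.IsPure xorAndPred) (hS : SimpleOverlap I) (S : Finset (Fin m)) (Γ : Finset (Fin n))
    (c : Fin n → ZMod 2) (κ : ZMod 2)
    (h : ∀ x : Fin n → ZMod 2, (∀ v ∈ Γ, x v = c v) → qform S (fun j => I.vars j 2) (fun j => I.vars j 3) x = κ) :
    ∀ j ∈ S, I.vars j 2 ∈ Γ ∨ I.vars j 3 ∈ Γ := by
  classical
  intro j hj
  by_contra hnot
  push Not at hnot
  obtain ⟨haΓ, hbΓ⟩ := hnot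
  -- the base point of the flat: `c` on `Γ`, zero elsewhere
  set x₀ : Fin n → ZMod 2 := fun v => if v ∈ Γ then c v else 0 with hx₀
  set ea : Fin n → ZMod 2 := Pi.single (I.vars j 2) 1 with hea
  set eb : Fin n → ZMod 2 := Pi.single (I.vars j 3) 1 with heb
  have hx₀Γ : ∀ v ∈ Γ, x₀ v = c v := fun v hv => by rw [hx₀]; exact if_pos hv
  have heaΓ : ∀ v ∈ Γ, ea v = 0 := fun v hv => by
    rw [hea]; exact Pi.single_eq_of_ne (fun h : v = I.vars j 2 => haΓ (h ▸ hv)) _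
  have hebΓ : ∀ v ∈ Γ, eb v = 0 := fun v hv => by
    rw [heb]; exact Pi.single_eq_of_ne (fun h : v = I.vars j 3 => hbΓ (h ▸ hv)) _
  have h1 := h x₀ hx₀Γ
  have h2 := h (x₀ + ea) (fun v hv => by rw [Pi.add_apply, hx₀Γ v hv, heaΓ v hv, add_zero])
  have h3 := h (x₀ + eb) (fun v hv => by rw [Pi.add_apply, hx₀Γ v hv, hebΓ v hv, add_zero])
  have h4 := h (x₀ + ea + eb) (fun v hv => by rw [Pi.add_apply, Pi.add_apply, hx₀Γ v hv, heaΓ v hv, hebΓ v hv, add_zero, add_zero])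
  rw [qform_add, h2, LinearMap.map_add₂] at h4
  rw [qform_add, h1] at h3
  have hab : polar S (fun j => I.vars j 2) (fun j => I.vars j 3) ea eb = 1 := by
    rw [hea, heb, polar_basis I hI hS S]
    exact if_pos ⟨j, hj, Or.inl ⟨rfl, rfl⟩⟩
  rw [hab] at h4
  have key : ∀ k q b : ZMod 2, k + q + b = k → k + q + (b + 1) = k → False := by decide
  exact key _ _ _ h3 h4

end Summit.PneNP.PneNP.Theorems.PstarGateCasePNor
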